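import Summits.BirchSwinnertonDyer.BirchSwinnertonDyer.Theorems.CMKolyvaginAtInertTwoShaCountCompositeAtTwo
import Summits.BirchSwinnertonDyer.BirchSwinnertonDyer.Theorems.GenusKolyvaginAtTwoPowDvdShaCardAtTwoRTTwoTorsionQuadratic
import Summits.BirchSwinnertonDyer.BirchSwinnertonDyer.Theorems.GenusKolyvaginAtTwoRankOneShaCellBSDTwoLocalTwoTorsionParity
import Literature.NumberTheory.EllipticCurves.QuadraticTwistTamagawaI0starExactProofs
import Literature.NumberTheory.EllipticCurves.BSDQuadraticDescentTorsionOddPartProofs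
import Literature.NumberTheory.EllipticCurves.Rank1Residual.X10Proofs
import Literature.NumberTheory.EllipticCurves.LFunctionSmulProofs
import Literature.NumberTheory.EllipticCurves.BSDInvariantsProofs
import Literature.NumberTheory.EllipticCurves.GlobalMinimalModel
import Literature.NumberTheory.EllipticCurves.LeadingTerm
import Literature.FieldTheory.FiniteFields.CubicDiscriminantRootParity
import HarnessLib

/-!
# GK₂ route `GenusKolyvaginAtTwo`, crux `RankOneShaCellBSDTwo` (stmt-27477), LINE 41 «restriction_rigidity»:
# stub ISO₂ `ShaQuadraticBookkeepingAtTwo` — PROVED MODULO ITS TWO PRINT INPUTS (GZK, Milne any-model)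

THEOREMS ONLY (no definition, no named fact, no `sorry`; standard axioms).  Nothing about BSD or the crux is
proved; the research stubs of LINE 41 (K-ANN₁, NDIV|Ш-slack) are untouched.

`shaQuadraticBookkeepingAtTwo_of_facts :
  rank_eq_analyticRank_of_analyticRank_le_one → Milne1972.bsdQuotient_baseChange_quadratic_anyModel → <ISO₂ text>`
— the TEXT of LINE 41 v1.9's `ShaQuadraticBookkeepingAtTwo` with `localTwoTorsionDim` unfolded, behind the two
route PRINT items `MultPublishedInputsAtTwo` (= GZK, stmt-19921) and `MilneAnyModel` (stmt-24149), so that the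
stub closes BY NAME once re-typed `MultPublishedInputsAtTwo → MilneAnyModel → ShaQuadraticBookkeepingAtTwo`
(rider R-LEAD-41c, same shape as RIG's R-LEAD-41a).

The `2`-adic substance is the sibling cell's (bsd-print-cf2, seat bsd-line-cmk2-p1 g15) COUNT IDENTITY
`ShaCountTwo.padicValNat_two_shaOrder_baseChange_eq_of_milne_composite`
(`ord₂ #Ш(E_K) + 1 = [Δ>0] + ord₂ #Ш(E) + ord₂ #Ш(Wd) + Σ_{q∣d_K}([(Δ/q)=−1] + 2[(Δ/q)=1 ∧ a_q even])`,
every odd `d_K`, modulo Milne).  This file supplies the ADAPTER to the Ш-cell frame: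
* GZK ⟹ `rank W = 1`, `rank Wd = 0`, `Ш(W)`, `Ш(Wd)` finite (`L(W^{(d_K)},1) ≠ 0` ⟹ `r_an(Wd) = 0`);
* `W(ℚ)[2] = 0 ⟹ W(K)[2] = 0` (tree `PlusDescent.forall_two_smul_eq_zero_baseChange_of_finrank_eq_two`);
* **`|u_d| = 1` for EVERY globally minimal model of the twin** (`abs_u_eq_one_of_isGloballyMinimal_twist`): the
  tree's `ShaCountTwo.exists_isGloballyMinimal_twist_of_heegner` produces one with `|u| = 1`, and two globally
  minimal models differ by `u = ±1` (`isGloballyMinimal_unique_holds`);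
* the DICTIONARY `i_q(W) = log₂(1 + #roots of ψ mod q) = [(Δ/q)=−1] + 2[(Δ/q)=1 ∧ a_q even]`
  (`localTwoTorsionDim_eq_dictionary`, from `TwistIstar.padicValNat_two_one_add_card_filter_twoTorsion` and
  the root count `∈ {0,1,3}` of `Literature/FieldTheory/FiniteFields/CubicDiscriminantRootParity`);
* `#A[2^∞] = 2^{v₂ #A}` (`natCard_primaryComponent_eq_pow_padicValNat`) and PAR for the truncated exponent.
[cite: Milne1972ArithmeticAV, §1 Thm. 1 (through DokchitserDokchitserAnnals2010, §2.1)] [cite: Kramer1981, Prop. 3 and Thm. 1]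
-/

noncomputable section

open scoped Classical NumberField

namespace Summit.BirchSwinnertonDyer.BirchSwinnertonDyer.Theorems.GenusExact.ShaCell.Bookkeeping

open WeierstrassCurve NumberField Literature.NumberTheory.EllipticCurves Polynomial

/-! ## §1. `|u| = 1` for every globally minimal model of the twin -/

/-- **Every globally minimal `ℚ`-model of the Heegner twin is reached from `W^{(d_K)}` with `|u| = 1`**
(`W/ℚ` globally minimal, `K` imaginary quadratic with odd `d_K` and the Heegner hypothesis): the tree builds ONE
such model (`exists_isGloballyMinimal_twist_of_heegner`), and two globally minimal models of the same curve differ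
by `u = ±1` (Silverman VIII.8.3, tree `isGloballyMinimal_unique_holds`). [cite: SilvermanAEC2009, VII.1.3(b) and VIII.8.3] -/
theorem abs_u_eq_one_of_isGloballyMinimal_twist (W : WeierstrassCurve ℚ) [W.IsElliptic] [W.IsGloballyMinimal]
    (K : Type) [Field K] [NumberField K] (hK : IsImaginaryQuadratic K) (hodd : Odd (NumberField.discr K))
    (hH : SatisfiesHeegnerHypothesis (W.conductorNorm ℤ) K)
    (Wd : WeierstrassCurve ℚ) [Wd.IsElliptic] [Wd.IsGloballyMinimal] (Cd : VariableChange ℚ)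
    (hWd : Cd • W.quadraticTwist (NumberField.discr K : ℚ) = Wd) : |(Cd.u : ℚ)| = 1 := by
  obtain ⟨W₀, C₀, hW₀, hu₀, hE₀, hmin₀⟩ :=
    ShaCountTwo.exists_isGloballyMinimal_twist_of_heegner W K hK hodd hH
  haveI := hE₀
  haveI := hmin₀
  -- `Wd = (Cd * C₀⁻¹) • W₀`
  have hrel : (Cd * C₀⁻¹) • W₀ = Wd := by
    rw [← hW₀, smul_smul, inv_mul_cancel_right, hWd]
  haveI : ((Cd * C₀⁻¹) • W₀).IsGloballyMinimal := by rw [hrel]; infer_instance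
  have hu := (isGloballyMinimal_unique_holds W₀ (Cd * C₀⁻¹)).1
  have hmul : ((Cd * C₀⁻¹).u : ℚ) = (Cd.u : ℚ) * ((C₀.u : ℚ))⁻¹ := by
    rw [VariableChange.mul_def, VariableChange.inv_def]
    simp
  have h0 : (C₀.u : ℚ) ≠ 0 := C₀.u.ne_zero
  have habs : |(Cd.u : ℚ)| * |(C₀.u : ℚ)|⁻¹ = 1 := by
    rw [← abs_inv, ← abs_mul, ← hmul]
    rcases hu with h | h <;> rw [h] <;> simp
  rw [hu₀, inv_one, mul_one] at habs
  exact habs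

/-! ## §2. The dictionary `i_q = [(Δ/q) = −1] + 2[(Δ/q) = 1 ∧ a_q even]` at a good odd prime -/

/-- The `2`-division cubic of the reduction mod `q` of the integer minimal model, evaluated: `4x³ + b₂x² + 2b₄x + b₆`.
[folklore] -/
private theorem eval_twoTorsionPolynomial_map (M : WeierstrassCurve ℤ) (q : ℕ) (x : ZMod q) :
    (WeierstrassCurve.twoTorsionPolynomial (M.map (Int.castRingHom (ZMod q)))).toPoly.eval x =
      4 * x ^ 3 + (M.b₂ : ZMod q) * x ^ 2 + 2 * (M.b₄ : ZMod q) * x + (M.b₆ : ZMod q) := by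
  simp only [WeierstrassCurve.twoTorsionPolynomial, Cubic.toPoly, map_b₂, map_b₄, map_b₆, eq_intCast,
    eval_add, eval_mul, eval_C, eval_pow, eval_X]

/-- For `c ∈ {0, 1, 3}`, `log₂ (c + 1) = v₂ (1 + c)` (both are `0, 1, 2`). [folklore] -/
private theorem log_two_eq_padicValNat_of_trichotomy {c : ℕ} (hc : c = 0 ∨ c = 1 ∨ c = 3) :
    Nat.log 2 (c + 1) = padicValNat 2 (1 + c) := by
  haveI : Fact (Nat.Prime 2) := ⟨Nat.prime_two⟩
  have hl2 : Nat.log 2 2 = 1 := by simpa using Nat.log_pow (b := 2) one_lt_two 1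
  have hl4 : Nat.log 2 4 = 2 := by simpa using Nat.log_pow (b := 2) one_lt_two 2
  have hv4 : padicValNat 2 4 = 2 := by
    rw [show (4 : ℕ) = 2 ^ 2 by norm_num, padicValNat.prime_pow]
  rcases hc with rfl | rfl | rfl
  · simp
  · simp [hl2]
  · simp [hl4, hv4]

/-- **THE DICTIONARY**: at an odd prime `q ∤ Δ_min` of the globally minimal `W`,
`i_q(W) = log₂ (1 + #{x ∈ 𝔽_q : ψ(x) = 0}) = [(Δ_min/q) = −1] + 2·[(Δ_min/q) = 1 ∧ a_q(W) even]`
(`ψ = 4x³ + b₂x² + 2b₄x + b₆` the `2`-division cubic of the minimal model; Kramer 1981 p. 125; tree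
`TwistIstar.padicValNat_two_one_add_card_filter_twoTorsion` with the root count `∈ {0,1,3}`). [cite: Kramer1981, §2 proof of Prop. 3 (p. 125)] -/
theorem localTwoTorsionDim_eq_dictionary (W : WeierstrassCurve ℚ) [W.IsElliptic] [W.IsGloballyMinimal]
    {q : ℕ} (hq : q.Prime) (hq2 : q ≠ 2) (hqΔ : ¬ (q : ℤ) ∣ minimalDiscriminantInt W) :
    Nat.log 2 (Nat.card {x : ZMod q // (WeierstrassCurve.twoTorsionPolynomial
        ((WeierstrassCurve.integralModelInt W).map (Int.castRingHom (ZMod q)))).toPoly.eval x = 0} + 1) =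
      (if jacobiSym W.Δ.num q = -1 then 1 else 0) +
        (if jacobiSym W.Δ.num q = 1 ∧ Even (W.frobeniusTrace q) then 2 else 0) := by
  haveI : Fact q.Prime := ⟨hq⟩
  haveI : NeZero q := ⟨hq.ne_zero⟩
  have hnum : W.Δ.num = minimalDiscriminantInt W := by
    rw [← cast_minimalDiscriminantInt W, Rat.num_intCast]
  rw [hnum, ← TwistIstar.padicValNat_two_one_add_card_filter_twoTorsion W q hq2 hqΔ]
  -- the subtype is the filter
  set M := integralModelInt W with hM
  set P : Cubic (ZMod q) := WeierstrassCurve.twoTorsionPolynomial (M.map (Int.castRingHom (ZMod q))) with hP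
  have hcard : Nat.card {x : ZMod q // P.toPoly.eval x = 0} =
      (Finset.univ.filter fun x : ZMod q =>
        4 * x ^ 3 + (M.b₂ : ZMod q) * x ^ 2 + 2 * (M.b₄ : ZMod q) * x + (M.b₆ : ZMod q) = 0).card := by
    rw [Nat.card_eq_fintype_card, Fintype.card_subtype]
    congr 1
    ext x
    simp only [Finset.mem_filter, Finset.mem_univ, true_and, hP, eval_twoTorsionPolynomial_map]
  -- the root count is `0`, `1` or `3`
  have h2 : (2 : ZMod q) ≠ 0 := by
    intro h
    have h' : ((2 : ℕ) : ZMod q) = 0 := by exact_mod_cast h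
    rcases (Nat.dvd_prime Nat.prime_two).mp ((ZMod.natCast_eq_zero_iff 2 q).mp h') with h1 | h1
    · exact hq.one_lt.ne' h1
    · exact hq2 h1
  have ha : P.a ≠ 0 := by
    change (4 : ZMod q) ≠ 0
    rw [show (4 : ZMod q) = 2 ^ 2 by norm_num]
    exact pow_ne_zero 2 h2
  have hΔ : (M.map (Int.castRingHom (ZMod q))).Δ ≠ 0 := by
    rw [WeierstrassCurve.map_Δ, eq_intCast]
    exact fun h0 => hqΔ ((ZMod.intCast_zmod_eq_zero_iff_dvd _ q).mp h0)
  have hd : P.discr ≠ 0 := by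
    rw [hP, WeierstrassCurve.twoTorsionPolynomial_discr]
    exact mul_ne_zero (by rw [show (16 : ZMod q) = 2 ^ 4 by norm_num]; exact pow_ne_zero 4 h2) hΔ
  have htri := Literature.FieldTheory.FiniteFields.CubicDiscriminantRootParity.card_roots_eq_zero_or_one_or_three ha hd
  have hcard' : Nat.card {x : ZMod q // P.toPoly.eval x = 0} = P.toPoly.roots.toFinset.card := by
    have e : {x : ZMod q // P.toPoly.eval x = 0} ≃ {x : ZMod q // x ∈ P.toPoly.roots.toFinset} :=
      Equiv.subtypeEquivRight fun x => by
        rw [Multiset.mem_toFinset, mem_roots (Cubic.ne_zero_of_a_ne_zero ha), IsRoot.def]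
    rw [Nat.card_congr e, Nat.card_eq_fintype_card, Fintype.card_coe]
  rw [← hcard, log_two_eq_padicValNat_of_trichotomy (by rw [hcard']; exact htri)]

/-! ## §3. ISO₂ modulo its two PRINT inputs -/

/-- **ISO₂ — LINE 41's `ShaQuadraticBookkeepingAtTwo`, PROVED MODULO GZK (`MultPublishedInputsAtTwo`) AND MILNE
ANY-MODEL (`MilneAnyModel`)**: on a Ш-cell frame (`W/ℚ` globally minimal, `r_an = 1`, no rational `2`-torsion; `K`
imaginary quadratic, `d_K` odd, Heegner for `N(W)`; `Wd` a globally minimal model of `W^{(d_K)}` with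
`L(W^{(d_K)},1) ≠ 0`),
**`#Ш(W_K)[2^∞] = #Ш(W)[2^∞] · #Ш(Wd)[2^∞] · 2^{Σ_{ℓ∣d_K} i_ℓ(W) + 𝟙[0<Δ_W] − 1}`**, `i_ℓ = log₂(1 + #roots of the
2-division cubic of the minimal model mod ℓ)` — the line's text verbatim (incl. the idle binders `¬CM`, `d_K ≠ −3`,
`2` split, `Finite Ш(W_K)[2^∞]`).  [cite: Milne1972ArithmeticAV, §1 Thm. 1 (through DokchitserDokchitserAnnals2010, §2.1)]
[cite: Kramer1981, Prop. 3 and Thm. 1] -/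
theorem shaQuadraticBookkeepingAtTwo_of_facts
    (hGZK : rank_eq_analyticRank_of_analyticRank_le_one)
    (hMilne : Milne1972.bsdQuotient_baseChange_quadratic_anyModel) :
    ∀ (W : WeierstrassCurve ℚ) [W.IsElliptic] [W.IsGloballyMinimal] [NeZero (W.conductorNorm ℤ)],
    ¬ W.HasCM → W.analyticRank = 1 → (∀ P : W.toAffine.Point, 2 • P = 0 → P = 0) →
    ∀ (K : Type) [Field K] [NumberField K], IsImaginaryQuadratic K →
      Odd (NumberField.discr K) → NumberField.discr K ≠ -3 → SatisfiesHeegnerHypothesis (W.conductorNorm ℤ) K →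
      ((Ideal.span {(2 : ℤ)}).primesOver (𝓞 K)).ncard = 2 →
      ∀ (Wd : WeierstrassCurve ℚ) [Wd.IsElliptic] [Wd.IsGloballyMinimal],
        (∃ C : VariableChange ℚ, C • W.quadraticTwist (NumberField.discr K : ℚ) = Wd) →
      (W.quadraticTwist (NumberField.discr K : ℚ)).entireLFunction 1 ≠ 0 →
        Finite (AddCommGroup.primaryComponent (W.baseChange K).sha 2) →
        Nat.card (AddCommGroup.primaryComponent (W.baseChange K).sha 2) =
          Nat.card (AddCommGroup.primaryComponent W.sha 2) * Nat.card (AddCommGroup.primaryComponent Wd.sha 2) *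
            2 ^ (Finset.sum (NumberField.discr K).natAbs.primeFactors (fun ℓ =>
                Nat.log 2 (Nat.card {x : ZMod ℓ // (WeierstrassCurve.twoTorsionPolynomial
                  ((WeierstrassCurve.integralModelInt W).map (Int.castRingHom (ZMod ℓ)))).toPoly.eval x = 0} + 1))
              + (if 0 < W.Δ then 1 else 0) - 1) := by
  intro W _ _ _ _ hr hT K _ _ hK hodd _ hH _ Wd _ _ hWd hL _
  haveI : Fact (Nat.Prime 2) := ⟨Nat.prime_two⟩
  have hD : (NumberField.discr K : ℚ) ≠ 0 := by exact_mod_cast NumberField.discr_ne_zero K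
  haveI := W.isElliptic_quadraticTwist hD
  obtain ⟨Cd, hCd⟩ := hWd
  -- GZK: ranks and finiteness
  obtain ⟨hrkW, hShaW⟩ := hGZK W hr.le
  rw [hr] at hrkW
  have hrd0 : Wd.analyticRank = 0 := by
    rw [← hCd, analyticRank_smul]
    exact Rank1Residual.analyticRank_eq_zero_of_entireLFunction_one_ne_zero hL
  obtain ⟨hrkWd, hShaWd⟩ := hGZK Wd (by rw [hrd0]; exact zero_le_one)
  rw [hrd0] at hrkWd
  haveI : Finite W.sha := hShaW
  haveI : Finite Wd.sha := hShaWd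
  have hrk : W.mordellWeilRank + Wd.mordellWeilRank = 1 := by rw [hrkW, hrkWd]
  -- no `2`-torsion over `K`
  have hT' := fun (Q : W.toAffine.Point)
      (hQ : @HSMul.hSMul ℕ W.toAffine.Point W.toAffine.Point
        (@instHSMul ℕ W.toAffine.Point (@NSMul.toSMul W.toAffine.Point (@AddMonoid.toNSMul W.toAffine.Point
          (@SubNegMonoid.toAddMonoid W.toAffine.Point (@AddGroup.toSubNegMonoid W.toAffine.Point
            (@AddCommGroup.toAddGroup W.toAffine.Point
              (@Affine.Point.instAddCommGroup ℚ _ W.toAffine fun a b => Classical.propDecidable (a = b)))))))) 2 Q = 0) =>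
    hT Q (by convert hQ using 9)
  have h2t : ∀ P : (W.baseChange K).toAffine.Point, (2 : ℕ) • P = 0 → P = 0 := fun P hP =>
    PlusDescent.forall_two_smul_eq_zero_baseChange_of_finrank_eq_two W K hK.1 two_ne_zero hT' P hP
  -- `|u_d| = 1`
  have hu : |(Cd.u : ℚ)| = 1 := abs_u_eq_one_of_isGloballyMinimal_twist W K hK hodd hH Wd Cd hCd
  -- the count identity of the sibling cell
  obtain ⟨hfin, hval⟩ := ShaCountTwo.padicValNat_two_shaOrder_baseChange_eq_of_milne_composite W K hK hodd hH
    Wd Cd hCd hu hrk h2t hMilne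
  haveI : Finite (W.baseChange K).sha := hfin
  -- the dictionary, prime by prime over `d_K`
  have hsum : (Finset.sum (NumberField.discr K).natAbs.primeFactors (fun ℓ =>
      Nat.log 2 (Nat.card {x : ZMod ℓ // (WeierstrassCurve.twoTorsionPolynomial
        ((WeierstrassCurve.integralModelInt W).map (Int.castRingHom (ZMod ℓ)))).toPoly.eval x = 0} + 1))) =
      ∑ q ∈ (NumberField.discr K).natAbs.primeFactors,
        ((if jacobiSym W.Δ.num q = -1 then 1 else 0) +
          (if jacobiSym W.Δ.num q = 1 ∧ Even (W.frobeniusTrace q) then 2 else 0)) := by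
    refine Finset.sum_congr rfl fun ℓ hℓ => ?_
    have hℓp : ℓ.Prime := Nat.prime_of_mem_primeFactors hℓ
    have hℓd : ℓ ∣ (NumberField.discr K).natAbs := Nat.dvd_of_mem_primeFactors hℓ
    have hℓ2 : ℓ ≠ 2 := by
      rintro rfl
      exact (Int.natAbs_even.not.mpr (Int.not_even_iff_odd.mpr hodd)) (even_iff_two_dvd.mpr hℓd)
    exact localTwoTorsionDim_eq_dictionary W hℓp hℓ2
      (LocalParity.not_dvd_minimalDiscriminantInt_of_dvd_discr W hK.1 hH hℓp (Int.natCast_dvd.mpr hℓd))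
  -- PAR: `1 ≤ Σ i_ℓ + 𝟙[0<Δ]`
  have hPAR := LocalParity.localTwoTorsionParity W K hK hodd hH
  -- assemble the `2`-adic valuations
  rw [natCard_primaryComponent_eq_pow_padicValNat 2 (A := (W.baseChange K).sha),
    natCard_primaryComponent_eq_pow_padicValNat 2 (A := W.sha),
    natCard_primaryComponent_eq_pow_padicValNat 2 (A := Wd.sha), ← pow_add, ← pow_add]
  congr 1
  change padicValNat 2 (W.baseChange K).shaOrder = padicValNat 2 W.shaOrder + padicValNat 2 Wd.shaOrder + _
  rw [hsum] at hPAR ⊢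
  by_cases hΔ : 0 < W.Δ
  · rw [if_pos hΔ] at hval ⊢
    omega
  · rw [if_neg hΔ] at hval ⊢
    have hneg : W.Δ < 0 := lt_of_le_of_ne (not_lt.mp hΔ) W.isUnit_Δ.ne_zero
    rw [if_pos hneg] at hPAR
    omega

end Summit.BirchSwinnertonDyer.BirchSwinnertonDyer.Theorems.GenusExact.ShaCell.Bookkeeping

end
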